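import Summits.QuantumFields.YangMills.Theorems.FemtoTransferGapMultiplierIMS
import Summits.QuantumFields.YangMills.Theorems.LuscherReductionRunningReductionLatticeIMSDefect
import HarnessLib

/-!
# The product (ground-state transformation) inequality for LINK-LIPSCHITZ multipliers: `P_s(gη) ≤ P-part + ½|E|²Λ²·M₂(β)c_β^{|E|−1}‖η‖²`
# (support module for crux `DressedRitz` stmt-QuantumFields-20205, line «polyakovlift» r6, F8 of `R6-DESIGN.md` §3(d); seat ym-infvol-p1 g7)

`Theorems/FemtoTransferGapMultiplierIMS.lean` proves, for the symmetric `SU(2)` transfer kernel, the exact product identity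
`s‖gη‖² − ⟨gη,K(gη)⟩ = (s⟨g²η,η⟩ − ⟨g²η,Kη⟩) + ½∫∫ηKη(g(U) − g(V))²` and its one-sided form with a DEFECT-ROW bound
`∫ K_β(U,V)(g(U) − g(V))² dV ≤ M`.  `Theorems/LuscherReductionRunningReductionLatticeIMSDefect.lean` proves the defect-row bound for
LINK-LIPSCHITZ functions, `|g(U) − g(V)| ≤ Λ Σ_e ‖U_e − V_e‖_F ⇒ M = |E|²Λ²·linkM2 β·c_β^{|E|−1}` (`defectRow_le_lat`), and with the Laplace
moment bound `M = |E|²Λ²(3/β)·latCE L β` (`defectRow_le_of_pos_lat`).  This file is the two-line composition — the SOFT-ERROR estimate of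
the r6 plan, step (d), in closed form:

* `energy_mul_le_of_linkLipschitz` — `s‖gη‖² − ⟨gη,K_β(gη)⟩ ≤ (s⟨g²η,η⟩ − ⟨g²η, transferApply β η⟩) + ½|E|²Λ²·linkM2 β·c_β^{|E|−1}·‖η‖²`;
* `energy_mul_le_of_linkLipschitz_pos` — the same with `(3/β)·latCE L β` (`β > 0`);
* `qform_mul_mul_ge_of_linkLipschitz` — the form-currency version `⟨gη,K(gη)⟩ ≥ ⟨g²η,Kη⟩ − ½|E|²Λ²·linkM2 β·c_β^{|E|−1}‖η‖²`.

HONEST FRAMING: fixed-lattice kernel algebra; no choice of `g`, no statement about `β → ∞`; conditional femto rung R2b1; not a stub of the crux;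
not infinite volume, NOT THE CLAY GAP.  Sorry-free; no new definition, no named fact.
References: B. Simon, Ann. Phys. 146 (1983) §3 [cite: SimonB1983DiscreteSpectrum, §3]; M. Lüscher, NPB 219 (1983) [cite: Luscher1983, §3].
-/

set_option autoImplicit false

noncomputable section

open MeasureTheory Filter Topology Real
open scoped Matrix BigOperators
open Literature.MathematicalPhysics.QuantumFieldTheory
open Literature.MathematicalPhysics.QuantumLattice

namespace Summit.QuantumFields.YangMills.Theorems.FemtoTransferGap

variable {L : ℕ} [NeZero L]

/-- ★ **Form currency**: for a measurable bounded gauge- and twist-invariant LINK-LIPSCHITZ multiplier `g` (constant `Λ`), `β ≥ 0`, and a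
physical `η`: `⟨g²η, K_βη⟩ − ½|E|²Λ²·linkM2 β·c_β^{|E|−1}·‖η‖² ≤ ⟨gη, K_β(gη)⟩`. [cite: SimonB1983DiscreteSpectrum, §3] -/
theorem qform_mul_mul_ge_of_linkLipschitz {β : ℝ} (hβ : 0 ≤ β) {g : GaugeConfig 3 L SU2 → ℝ} (hgm : Measurable g)
    {Cg : ℝ} (hgb : ∀ U, |g U| ≤ Cg)
    (hgg : ∀ (k : Site 3 L → SU2) (U : GaugeConfig 3 L SU2), g (gaugeTransform k U) = g U)
    (hgz : ∀ (k : Fin 3), ∀ z ∈ Subgroup.center SU2, ∀ U : GaugeConfig 3 L SU2, g (twist k z U) = g U)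
    {Λ : ℝ} (hLip : ∀ U V : GaugeConfig 3 L SU2,
      |g U - g V| ≤ Λ * ∑ e, frobNorm ((U e : Matrix (Fin 2) (Fin 2) ℂ) - (V e : Matrix (Fin 2) (Fin 2) ℂ)))
    {η : GaugeConfig 3 L SU2 → ℝ} (hη : IsPhys η) :
    qform su2Rep β (fun U => g U ^ 2 * η U) η
        - (1 / 2) * ((Fintype.card (Edge 3 L) : ℝ) ^ 2 * Λ ^ 2 * (linkM2 β * linkC β ^ (Fintype.card (Edge 3 L) - 1))) * l2 η η
      ≤ qform su2Rep β (fun U => g U * η U) (fun U => g U * η U) := by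
  haveI : SecondCountableTopology SU2 := secondCountableTopology_su2
  exact qform_mul_mul_ge su2Rep continuous_su2Rep β (transferKernel_su2Rep_symm β) hgm hgb hgg hgz
    (fun U => defectRow_le_lat hβ hLip U) hη

/-- ★ **The SOFT-ERROR estimate in closed form** (operator currency, `T = transferApply β`): for `g` as above, `β ≥ 0`, every level `s` and every
physical `η`:
`s‖gη‖² − ⟨gη, K_β(gη)⟩ ≤ (s⟨g²η,η⟩ − ⟨g²η, Tη⟩) + ½|E|²Λ²·linkM2 β·c_β^{|E|−1}·‖η‖²`. [cite: Luscher1983, §3] [cite: SimonB1983DiscreteSpectrum, §3] -/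
theorem energy_mul_le_of_linkLipschitz {β : ℝ} (hβ : 0 ≤ β) {g : GaugeConfig 3 L SU2 → ℝ} (hgm : Measurable g)
    {Cg : ℝ} (hgb : ∀ U, |g U| ≤ Cg)
    (hgg : ∀ (k : Site 3 L → SU2) (U : GaugeConfig 3 L SU2), g (gaugeTransform k U) = g U)
    (hgz : ∀ (k : Fin 3), ∀ z ∈ Subgroup.center SU2, ∀ U : GaugeConfig 3 L SU2, g (twist k z U) = g U)
    {Λ : ℝ} (hLip : ∀ U V : GaugeConfig 3 L SU2,
      |g U - g V| ≤ Λ * ∑ e, frobNorm ((U e : Matrix (Fin 2) (Fin 2) ℂ) - (V e : Matrix (Fin 2) (Fin 2) ℂ)))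
    {η : GaugeConfig 3 L SU2 → ℝ} (hη : IsPhys η) (s : ℝ) :
    s * l2 (fun U => g U * η U) (fun U => g U * η U) - qform su2Rep β (fun U => g U * η U) (fun U => g U * η U)
      ≤ (s * l2 (fun U => g U ^ 2 * η U) η - l2 (fun U => g U ^ 2 * η U) (transferApply β η))
        + (1 / 2) * ((Fintype.card (Edge 3 L) : ℝ) ^ 2 * Λ ^ 2 * (linkM2 β * linkC β ^ (Fintype.card (Edge 3 L) - 1))) * l2 η η :=
  energy_mul_le_su2 β hgm hgb hgg hgz (fun U => defectRow_le_lat hβ hLip U) hη s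

/-- The same with the tree's Laplace moment bound `linkM2 β ≤ (3/β)c_β` (`β > 0`):
`s‖gη‖² − ⟨gη, K_β(gη)⟩ ≤ (s⟨g²η,η⟩ − ⟨g²η, Tη⟩) + ½|E|²Λ²(3/β)·latCE L β·‖η‖²`. [cite: Luscher1983, §3] [cite: SimonB1983DiscreteSpectrum, §3] -/
theorem energy_mul_le_of_linkLipschitz_pos {β : ℝ} (hβ : 0 < β) {g : GaugeConfig 3 L SU2 → ℝ} (hgm : Measurable g)
    {Cg : ℝ} (hgb : ∀ U, |g U| ≤ Cg)
    (hgg : ∀ (k : Site 3 L → SU2) (U : GaugeConfig 3 L SU2), g (gaugeTransform k U) = g U)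
    (hgz : ∀ (k : Fin 3), ∀ z ∈ Subgroup.center SU2, ∀ U : GaugeConfig 3 L SU2, g (twist k z U) = g U)
    {Λ : ℝ} (hLip : ∀ U V : GaugeConfig 3 L SU2,
      |g U - g V| ≤ Λ * ∑ e, frobNorm ((U e : Matrix (Fin 2) (Fin 2) ℂ) - (V e : Matrix (Fin 2) (Fin 2) ℂ)))
    {η : GaugeConfig 3 L SU2 → ℝ} (hη : IsPhys η) (s : ℝ) :
    s * l2 (fun U => g U * η U) (fun U => g U * η U) - qform su2Rep β (fun U => g U * η U) (fun U => g U * η U)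
      ≤ (s * l2 (fun U => g U ^ 2 * η U) η - l2 (fun U => g U ^ 2 * η U) (transferApply β η))
        + (1 / 2) * ((Fintype.card (Edge 3 L) : ℝ) ^ 2 * Λ ^ 2 * (3 / β) * latCE L β) * l2 η η :=
  energy_mul_le_su2 β hgm hgb hgg hgz (fun U => defectRow_le_of_pos_lat hβ hLip U) hη s

end Summit.QuantumFields.YangMills.Theorems.FemtoTransferGap

end
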